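import Literature.NumberTheory.Automorphic.SerreConjectureProofs
import Literature.NumberTheory.GaloisRepresentations.CalegariEvenFontaineMazurTwo
import Literature.RingTheory.Valuation.AlgClosedResidue
import Literature.NumberTheory.GaloisRepresentations.PadicAlgebraDegreeOnePlace
import Mathlib.FieldTheory.Galois.IsGaloisGroup
import Mathlib.RingTheory.Frobenius
import Mathlib.NumberTheory.NumberField.Discriminant.Different
import HarnessLib

/-!
# Residue embedding, Frobenius automorphism and discriminant of the dihedral field (brick AH1c of the odd-`p`
# Hecke theta partner)

Route `SignedLowerHalves`, child L `SmallImageLowerHalfBothSigns` (item stmt-BirchSwinnertonDyer-23599), line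
`rtt_w3`, stub K0₂@p `stub_heckeThetaPartner_ns` — construction brick AH1c of the arithmetic half at an ODD prime
(width seat `bsd-line-slh-p3-w3` gen 10; memo `Lines/birth_acns-MEMO-w3-g9.md` §2 «AH1»).  THEOREMS ONLY (no
definition, no named fact, no `sorry`); ROUTE-INDEPENDENT.

* `nonempty_ringHom_residue_of_pow` — a residue embedding `𝓀(\bar F) = \bar ℤ_F/𝔓 → k` into any algebraically
  closed field `k` of characteristic `p` exists for every non-archimedean local field `F` with `#𝓀(F) = pⁿ`
  (`n ≥ 1`): the tree's `nonempty_ringHom_residue` (`#𝓀(F) = p`) with the exponent generalised — `\bar ℤ_F/𝔓` is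
  algebraic over `𝔽_p` (`x^{q^m} = x`).  Applied with `k = ℤ̄_p/𝔪` (`padicAlgClResidueField`, algebraically
  closed of characteristic `p`) it gives the input `ι` of `heckeThetaPartner_of_inertField`.
* `exists_frobenius_ringHom` — for `K/ℚ` Galois (number field) and a place `v = p𝓞_K`, an automorphism `c` of `K`
  restricting to `cO : 𝓞 K → 𝓞 K` with `cO b ≡ b^p (mod v)` (Mathlib's arithmetic Frobenius
  `IsArithFrobAt.exists_of_isInvariant` for `Gal(K/ℚ)` acting on `𝓞 K` over `ℤ`): the inputs `c, cO, hcO, hc`.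
* `not_dvd_discr_of_isUnramifiedIn` — if the place `v₀ ∋ ℓ` of `ℚ` is unramified in `K` (over `𝓞 ℚ`) then
  `ℓ ∤ d_K` (Dedekind's discriminant theorem, Mathlib `NumberField.not_dvd_discr_iff_forall_mem`, transported from
  `ℤ` to `𝓞 ℚ`): the inputs `hpd`, `hdK`.

BSD, crux L and the stub are NOT proved here.

References: J.-P. Serre, Local Fields IV §4 (Cor. 2 to Prop. 16); J. Neukirch, ANT I §9 (9.4), III §2 (2.12).
-/

set_option autoImplicit false
set_option linter.dupNamespace false

noncomputable section

open scoped NumberField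
open Field NumberField IsDedekindDomain
  Literature.NumberTheory.GaloisRepresentations

namespace Summit.BirchSwinnertonDyer.BirchSwinnertonDyer.Theorems.SmallImageLambdaLowerThreeNsThetaPartner

/-! ### §1. Residue embeddings for residue fields of prime-power order -/

section Residue

open ValuativeRel Literature.NumberTheory.GaloisRepresentations.IsNonarchimedeanLocalField

set_option synthInstance.maxHeartbeats 200000 in
/-- **Residue embeddings exist** (prime-power residue cardinality).  Let `F` be a non-archimedean local field with
`#𝓀(F) = pⁿ`, `n ≠ 0`, and `k` an algebraically closed field of characteristic `p`.  Then there is a ring homomorphism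
`\bar ℤ_F/𝔓 → k` from the residue field of the integers of `F̄`.  (The tree's `nonempty_ringHom_residue` is the
case `n = 1`; same proof: `\bar ℤ_F/𝔓` has characteristic `p` and is algebraic over `𝔽_p`, every element
satisfying `x^{q^m} = x`, so `IsAlgClosed.lift` applies.) [cite: SerreLocalFields1979, Ch. IV §4 Cor. 2 to Prop. 16] -/
theorem nonempty_ringHom_residue_of_pow (p : ℕ) [Fact p.Prime] {k : Type} [Field k] [CharP k p] [IsAlgClosed k]
    (F : Type) [Field F] [ValuativeRel F] [TopologicalSpace F] [IsNonarchimedeanLocalField F]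
    {n : ℕ} (hn : n ≠ 0) (hF : residueFieldCard F = p ^ n) :
    Nonempty (absIntegers 𝒪[F] F ⧸ absMaximalIdeal F →+* k) := by
  classical
  letI : Field (absIntegers 𝒪[F] F ⧸ absMaximalIdeal F) := Ideal.Quotient.field _
  have hp : p.Prime := Fact.out
  -- the residue fields `𝓀[F]` and `S ⧸ 𝔓` have characteristic `p`
  haveI : Fintype 𝓀[F] := Fintype.ofFinite _
  have hcard : Fintype.card 𝓀[F] = p ^ n := by rw [Fintype.card_eq_nat_card]; exact hF
  haveI : CharP 𝓀[F] p := by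
    obtain ⟨r, hr⟩ := CharP.exists 𝓀[F]
    haveI := hr
    obtain ⟨m', hrp, hm'⟩ := FiniteField.card 𝓀[F] r
    have hrp' : r = p := by
      have h1 : r ∣ p ^ n := by rw [← hcard, hm']; exact dvd_pow_self _ (PNat.ne_zero m')
      exact (Nat.prime_dvd_prime_iff_eq hrp hp).mp (hrp.dvd_of_dvd_pow h1)
    subst hrp'
    exact hr
  haveI : CharP (absIntegers 𝒪[F] F ⧸ absMaximalIdeal F) p :=
    ((algebraMap 𝓀[F] (absIntegers 𝒪[F] F ⧸ absMaximalIdeal F)).charP_iff_charP p).mp inferInstance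
  letI : Algebra (ZMod p) (absIntegers 𝒪[F] F ⧸ absMaximalIdeal F) := ZMod.algebra _ p
  letI : Algebra (ZMod p) k := ZMod.algebra _ p
  -- `S ⧸ 𝔓` is algebraic over `𝔽_p`: `x ^ (p ^ (n m)) = x`
  haveI : Algebra.IsAlgebraic (ZMod p) (absIntegers 𝒪[F] F ⧸ absMaximalIdeal F) := by
    refine ⟨fun x => ?_⟩
    obtain ⟨b, rfl⟩ := Ideal.Quotient.mk_surjective x
    obtain ⟨m, hm, hbm⟩ := exists_pow_residueFieldCard_pow_sub_mem b
    refine ⟨Polynomial.X ^ p ^ (n * m) - Polynomial.X, ?_, ?_⟩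
    · simpa using FiniteField.X_pow_card_pow_sub_X_ne_zero (ZMod p) (Nat.mul_ne_zero hn hm.ne') hp.one_lt
    · have h := (Ideal.Quotient.eq_zero_iff_mem).mpr hbm
      rw [hF, ← pow_mul] at h
      simpa [map_sub, map_pow] using h
  -- vector spaces are torsion-free (stated by hand: the generic instances are not found in time)
  haveI : Module.IsTorsionFree (ZMod p) (absIntegers 𝒪[F] F ⧸ absMaximalIdeal F) :=
    .of_smul_eq_zero fun r m h => by
      by_cases hr : r = 0
      · exact Or.inl hr
      · exact Or.inr (by rw [← inv_smul_smul₀ hr m, h, smul_zero])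
  haveI : Module.IsTorsionFree (ZMod p) k :=
    .of_smul_eq_zero fun r m h => by
      by_cases hr : r = 0
      · exact Or.inl hr
      · exact Or.inr (by rw [← inv_smul_smul₀ hr m, h, smul_zero])
  exact ⟨(IsAlgClosed.lift (R := ZMod p) (M := k) (S := absIntegers 𝒪[F] F ⧸ absMaximalIdeal F)).toRingHom⟩

/-- **The residue embedding `ι : 𝓀(\bar K_v) → ℤ̄_p/𝔪`** at a place `v` of a number field `K` with `#𝓀(K_v) = p²`
(the input `ι` of `heckeThetaPartner_of_inertField`). [cite: SerreLocalFields1979, Ch. IV §4 Cor. 2 to Prop. 16] -/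
theorem nonempty_residueEmbedding (p : ℕ) [Fact p.Prime] {K : Type} [Field K] [NumberField K]
    (v : HeightOneSpectrum (𝓞 K)) (hq : residueFieldCard (v.adicCompletion K) = p ^ 2) :
    Nonempty (absIntegers 𝒪[v.adicCompletion K] (v.adicCompletion K) ⧸ absMaximalIdeal (v.adicCompletion K) →+*
      padicAlgClResidueField p) := by
  haveI : CharP (padicAlgClResidueField p) p := charP_padicAlgClResidueField p
  haveI : IsAlgClosed (padicAlgClResidueField p) :=
    Literature.RingTheory.Valuation.isAlgClosed_residueField (padicAlgClIntegers p)
  exact nonempty_ringHom_residue_of_pow p (v.adicCompletion K) two_ne_zero hq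

end Residue

/-! ### §2. The Frobenius automorphism at the inert prime -/

section Frobenius

variable (K : Type) [Field K] [NumberField K]

/-- **The Frobenius automorphism at `v = p𝓞_K`.**  For `K/ℚ` Galois and a place `v` of `K` with `v = p𝓞_K` there is
a ring endomorphism `c` of `K` restricting to `cO : 𝓞 K → 𝓞 K` with `cO b ≡ b ^ p (mod v)` for all `b` (an
arithmetic Frobenius of `Gal(K/ℚ)` at `v`, Mathlib `IsArithFrobAt.exists_of_isInvariant` for the Galois group acting
on `𝓞 K` over `ℤ`; `#(ℤ/(v ∩ ℤ)) = p`). [cite: NeukirchANT1999, Ch. I §9 Prop. (9.4)] -/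
theorem exists_frobenius_ringHom [IsGalois ℚ K] (p : ℕ) [Fact p.Prime] {v : HeightOneSpectrum (𝓞 K)}
    (hvp : v.asIdeal = Ideal.span {(p : 𝓞 K)}) :
    ∃ (c : K →+* K) (cO : 𝓞 K →+* 𝓞 K), (∀ b : 𝓞 K, ((cO b : 𝓞 K) : K) = c (b : K)) ∧
      ∀ b : 𝓞 K, cO b - b ^ p ∈ v.asIdeal := by
  classical
  have hp : p.Prime := Fact.out
  haveI : v.asIdeal.IsPrime := v.isPrime
  haveI : Finite (𝓞 K ⧸ v.asIdeal) := Ideal.finiteQuotientOfFreeOfNeBot v.asIdeal v.ne_bot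
  obtain ⟨σ, hσ⟩ := IsArithFrobAt.exists_of_isInvariant ℤ (K ≃ₐ[ℚ] K) v.asIdeal
  -- `v ∩ ℤ = (p)`, so the Frobenius exponent is `p`
  have hpZ : Prime (p : ℤ) := Nat.prime_iff_prime_int.mp hp
  have hunder : Ideal.span {(p : ℤ)} = v.asIdeal.under ℤ :=
    ((Ideal.liesOver_span_iff v.isPrime.ne_top hpZ).mpr
      (by rw [hvp]; exact_mod_cast Ideal.mem_span_singleton_self (p : 𝓞 K))).1
  have hcard : Nat.card (ℤ ⧸ v.asIdeal.under ℤ) = p := by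
    rw [← hunder, Nat.card_congr (Int.quotientSpanNatEquivZMod p).toEquiv, Nat.card_zmod]
  refine ⟨(σ : K ≃ₐ[ℚ] K).toRingEquiv.toRingHom, MulSemiringAction.toRingHom (K ≃ₐ[ℚ] K) (𝓞 K) σ,
    fun b => rfl, fun b => ?_⟩
  have h := hσ b
  rw [hcard] at h
  exact h

end Frobenius

/-! ### §3. Unramified primes do not divide the discriminant -/

section Discriminant

variable (K : Type) [Field K] [NumberField K]

/-- `ℤ → 𝓞 ℚ` is onto (it is an isomorphism), hence formally unramified. [folklore] -/
theorem formallyUnramified_int_ringOfIntegers_rat : Algebra.FormallyUnramified ℤ (𝓞 ℚ) := by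
  have hsurj : Function.Surjective (algebraMap ℤ (𝓞 ℚ)) := by
    intro x
    refine ⟨Rat.ringOfIntegersEquiv x, ?_⟩
    have h : (algebraMap ℤ (𝓞 ℚ)) = Rat.ringOfIntegersEquiv.symm.toRingHom := Subsingleton.elim _ _
    rw [h]
    exact Rat.ringOfIntegersEquiv.symm_apply_apply x
  exact Algebra.FormallyUnramified.of_surjective (Algebra.ofId ℤ (𝓞 ℚ)) hsurj

/-- **Unramified (over `𝓞 ℚ`) ⇒ unramified over `ℤ`** at a prime of `𝓞 K` (`ℤ → 𝓞 ℚ → (𝓞 K)_𝔓`, composition of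
formally unramified maps). [folklore] -/
theorem isUnramifiedAt_int_of_ringOfIntegers_rat (P : Ideal (𝓞 K)) [P.IsPrime]
    (h : Algebra.IsUnramifiedAt (𝓞 ℚ) P) : Algebra.IsUnramifiedAt ℤ P := by
  haveI := formallyUnramified_int_ringOfIntegers_rat
  haveI : Algebra.FormallyUnramified (𝓞 ℚ) (Localization.AtPrime P) := h
  exact Algebra.FormallyUnramified.comp ℤ (𝓞 ℚ) (Localization.AtPrime P)

/-- **Dedekind: a prime unramified in `K` does not divide `d_K`.**  If the place `v₀ ∋ ℓ` of `ℚ` is unramified in `K`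
(`Algebra.IsUnramifiedIn (𝓞 K) v₀`), then `ℓ ∤ d_K` (Mathlib `NumberField.not_dvd_discr_iff_forall_mem`).
[cite: NeukirchANT1999, Ch. III §2 Cor. (2.12)] -/
theorem not_dvd_discr_of_isUnramifiedIn {ℓ : ℕ} (hℓ : ℓ.Prime) {v₀ : HeightOneSpectrum (𝓞 ℚ)}
    (hℓv : (ℓ : 𝓞 ℚ) ∈ v₀.asIdeal) (hunr : Algebra.IsUnramifiedIn (𝓞 K) v₀.asIdeal) :
    ¬ (ℓ : ℤ) ∣ NumberField.discr K := by
  classical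
  have hℓZ : Prime (ℓ : ℤ) := Nat.prime_iff_prime_int.mp hℓ
  refine (NumberField.not_dvd_discr_iff_forall_mem K (𝓞 K) hℓZ).mpr fun P hP hmem => ?_
  haveI := hP
  -- `P` lies over `v₀`
  have hP0 : P ≠ ⊥ := by
    intro h
    rw [h, Ideal.mem_bot] at hmem
    exact (Int.cast_ne_zero.mpr (Int.natCast_ne_zero.mpr hℓ.ne_zero) : ((ℓ : ℤ) : 𝓞 K) ≠ 0) hmem
  set w : HeightOneSpectrum (𝓞 K) := ⟨P, hP, hP0⟩ with hw
  have hℓw : (ℓ : 𝓞 K) ∈ w.asIdeal := by exact_mod_cast hmem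
  have hunderw : w.under (𝓞 ℚ) = v₀ := by
    have h1 : (ℓ : 𝓞 ℚ) ∈ (w.under (𝓞 ℚ)).asIdeal := by
      rw [HeightOneSpectrum.under_asIdeal, Ideal.under_def, Ideal.mem_comap, map_natCast]
      exact hℓw
    haveI : Fact ℓ.Prime := ⟨hℓ⟩
    have e1 := LocalField.natGenerator_eq_of_natCast_mem ℓ _ h1
    have e2 := LocalField.natGenerator_eq_of_natCast_mem ℓ _ hℓv
    exact (Rat.HeightOneSpectrum.primesEquiv (R := 𝓞 ℚ)).injective (Subtype.ext (e1.trans e2.symm))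
  haveI : P.LiesOver v₀.asIdeal := ⟨by
    rw [← hunderw, HeightOneSpectrum.under_asIdeal]⟩
  exact isUnramifiedAt_int_of_ringOfIntegers_rat K P (hunr P hP inferInstance)

end Discriminant

end Summit.BirchSwinnertonDyer.BirchSwinnertonDyer.Theorems.SmallImageLambdaLowerThreeNsThetaPartner

end
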